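import Summits.AtomisticToContinuum.HydrodynamicLimit.Theorems.AntiMazurCoboundariesCorrectorPressureDecayEquivalences

/-!
# Strategy census (crux-strategist s1) — the LD/L² decomposition of the crux, TYPED AND GLUED

Crux stmt-AtomisticToContinuum-14135 `AntiMazurCoboundaries.CorrectorPressureDecay` ("X"), ⇔ `KineticFluxLdDecay`
(stmt-10967, p99142). This scratch file belongs to `STRATEGY-CENSUS.md` §Decomposition (D-LD): the only typed split of X
into two pieces NEITHER of which is known to be implied by X, with the glue PROVED here:

* `WindowCumulantDomination` (A, NEW, not filed): uniformly in `N`, the kinetic-window PRESSURE of a fast one-body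
  observable at small amplitude is dominated by `C ×` its kinetic-window second moment plus `δ(N+1)` — "LD ≤ C·L²",
  the large-deviation upgrade that reversible Markov dynamics get from Feynman–Kac/`H₋₁` and deterministic dynamics lack;
* `FastObservableMeanErgodic` (B = shared item stmt-10952, the L² wall, led on route FluxGibbsianityLdDrude).

`kineticFluxLdDecay_of_cumulantDomination : A → B → KineticFluxLdDecay` and `correctorPressureDecay_of_cumulantDomination :
A → B → X`. Verdict in the census: no leverage — B is the infinite-horizon decorrelation at fixed density in its weakest
(L²) currency (open; theorem-grade only in the dilute corner, milestone BoltzmannGreenKubo stmt-13985), A is open even in the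
Boltzmann–Grad corner (long-time equilibrium LARGE deviations: BGSSAnnals2023 reaches Lanford's time only).
-/

noncomputable section

open MeasureTheory ProbabilityTheory Set Filter Topology
open scoped ENNReal

namespace Summit.AtomisticToContinuum.HydrodynamicLimit.Cruxes.CorrectorPressureDecay.StrategyCensus

open Literature.MathematicalPhysics.KineticTheory (T3 V3 hsDiameter localGibbsLaw)
open Literature.Analysis.FluidPDE (HardSphereFlow)
open Summit.AtomisticToContinuum.HydrodynamicLimit.Theses.AntiMazurCoboundaries (CorrectorPressureDecay KineticFluxLdDecay)
open Summit.AtomisticToContinuum.HydrodynamicLimit.Theses.FluxGibbsianityLdDrude (FastObservableMeanErgodic)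

/-- **(A) WINDOW CUMULANT DOMINATION** ("LD ≤ C·L²" for kinetic-window sums of fast one-body observables, uniformly in
`N`): in the frame of `KineticFluxLdDecay`, for `σ < σ₀` there are an amplitude `κ > 0` and a constant `C > 0` such that for
all admissible `(φ, g)` (`|φ| ≤ 1`, `|g| ≤ κ`, `g ⊥ 1, v, |v|²`), every kinetic window `τ > 0` and every `δ > 0`, for
`N ≥ N₀(τ, δ)` and every flow `Φ`:
`∫ exp(A_τ) dG_N ≤ exp(C · ∫ A_τ² dG_N + δ(N+1))`, `A_τ` the window-`τℓ` time average of `Σᵢ φ(xᵢ) g((vᵢ−u₀)/√θ)`.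
True for sums of INDEPENDENT centred terms of size `≤ κ ≤ 1` (`log E e^{s} ≤ (e−2) E s²`); the amplitude clause is
necessary (spiky `g`); its failure mode at small `κ` is a finite-entropy non-perturbative stationary structure (the hidden
charge). NOT implied by X (it constrains every `τ`), does not imply X (needs (B)). Posited for the census only. -/
def WindowCumulantDomination : Prop :=
  ∀ (a θ : ℝ) (u₀ : V3), 0 < a → 0 < θ → ∃ σ₀ : ℝ, 0 < σ₀ ∧ ∀ σ : ℝ, 0 < σ → σ < σ₀ →
    ∃ κ : ℝ, 0 < κ ∧ ∃ C : ℝ, 0 < C ∧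
    ∀ (φ : T3 → ℝ) (g : V3 → ℝ), Continuous φ → Continuous g → (∀ x, |φ x| ≤ 1) → (∀ v, |g v| ≤ κ) →
      (∀ (c₀ c₂ : ℝ) (b : V3), ∫ v, g v * (c₀ + inner ℝ b v + c₂ * ‖v‖ ^ 2) ∂(stdGaussian V3) = 0) →
      ∀ τ : ℝ, 0 < τ → ∀ δ : ℝ, 0 < δ → ∃ N₀ : ℕ, ∀ N : ℕ, N₀ ≤ N →
        ∀ Φ : HardSphereFlow (Literature.Analysis.FluidPDE.Torus.geometry (Fin 3)) (hsDiameter σ N) (N + 1),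
          ∫⁻ z, ENNReal.ofReal (Real.exp ((τ * ((N + 1 : ℕ) : ℝ) ^ (-(1 / 3 : ℝ)))⁻¹ *
              ∫ s in (0 : ℝ)..(τ * ((N + 1 : ℕ) : ℝ) ^ (-(1 / 3 : ℝ))),
                ∑ i, φ (Φ.flow s z i).1 * g ((Real.sqrt θ)⁻¹ • ((Φ.flow s z i).2 - u₀))))
            ∂(localGibbsLaw σ (fun _ => a) (fun _ => u₀) (fun _ => θ) N Φ) ≤
          ENNReal.ofReal (Real.exp (C *
            (∫⁻ z, ENNReal.ofReal (((τ * ((N + 1 : ℕ) : ℝ) ^ (-(1 / 3 : ℝ)))⁻¹ *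
              ∫ s in (0 : ℝ)..(τ * ((N + 1 : ℕ) : ℝ) ^ (-(1 / 3 : ℝ))),
                ∑ i, φ (Φ.flow s z i).1 * g ((Real.sqrt θ)⁻¹ • ((Φ.flow s z i).2 - u₀))) ^ 2)
              ∂(localGibbsLaw σ (fun _ => a) (fun _ => u₀) (fun _ => θ) N Φ)).toReal + δ * (N + 1)))

/-- **GLUE OF THE SPLIT (D-LD), PROVED**: cumulant domination (A) and the L² wall (B, stmt-10952) give the shared LD wall
`KineticFluxLdDecay` (stmt-10967): given `δ`, take the window `τ` of (B) at tolerance `δ/(2C)`, then `N₀` from (A) at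
`(τ, δ/2)`. -/
theorem kineticFluxLdDecay_of_cumulantDomination (hA : WindowCumulantDomination) (hB : FastObservableMeanErgodic) :
    KineticFluxLdDecay := by
  intro a θ u₀ ha hθ
  obtain ⟨σA, hσA, hA⟩ := hA a θ u₀ ha hθ
  obtain ⟨σB, hσB, hB⟩ := hB a θ u₀ ha hθ
  refine ⟨min σA σB, lt_min hσA hσB, fun σ hσ hσlt => ?_⟩
  have hσA' : σ < σA := hσlt.trans_le (min_le_left _ _)
  have hσB' : σ < σB := hσlt.trans_le (min_le_right _ _)
  obtain ⟨hprob, hBσ⟩ := hB σ hσ hσB'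
  obtain ⟨κ, hκ, C, hC, hAσ⟩ := hA σ hσ hσA'
  refine ⟨hprob, κ, hκ, fun φ g hφ hg hφ1 hgκ horth δ hδ => ?_⟩
  obtain ⟨τ, hτ, N₁, hB1⟩ := hBσ φ g hφ hg ⟨κ, hgκ⟩ horth (δ / (2 * C)) (by positivity)
  obtain ⟨N₂, hA2⟩ := hAσ φ g hφ hg hφ1 hgκ horth τ hτ (δ / 2) (by positivity)
  refine ⟨τ, hτ, max N₁ N₂, fun N hN Φ => ?_⟩
  have h1 := hB1 N ((le_max_left _ _).trans hN) Φ
  have h2 := hA2 N ((le_max_right _ _).trans hN) Φ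
  refine h2.trans (ENNReal.ofReal_le_ofReal (Real.exp_le_exp.2 ?_))
  have hN0 : (0 : ℝ) ≤ δ / (2 * C) * (N + 1) := by positivity
  have h3 := ENNReal.toReal_le_of_le_ofReal hN0 h1
  have h4 := mul_le_mul_of_nonneg_left h3 hC.le
  have h5 : C * (δ / (2 * C) * ((N : ℝ) + 1)) = δ / 2 * ((N : ℝ) + 1) := by
    field_simp
  linarith

/-- The split reaches the crux BY NAME (through the landed `correctorPressureDecay_of_kineticFluxLdDecay`, p99142). -/
theorem correctorPressureDecay_of_cumulantDomination (hA : WindowCumulantDomination) (hB : FastObservableMeanErgodic) :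
    CorrectorPressureDecay :=
  Summit.AtomisticToContinuum.HydrodynamicLimit.Theorems.CorrectorPressureDecayEquivalences.correctorPressureDecay_of_kineticFluxLdDecay
    (kineticFluxLdDecay_of_cumulantDomination hA hB)

end Summit.AtomisticToContinuum.HydrodynamicLimit.Cruxes.CorrectorPressureDecay.StrategyCensus

end
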